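import Mathlib
import HarnessLib
import Summits.HubbardSuperconductivity.HubbardSuperconductivity.Theorems.KLProgrammeKLRegimeEngineTwoShellFrameZero
import Summits.HubbardSuperconductivity.HubbardSuperconductivity.Theorems.KLProgrammePerturbedFermiCurveUniformAngular
import Summits.HubbardSuperconductivity.HubbardSuperconductivity.Theorems.KLProgrammePerturbedFermiCurveFrameGaussRate

/-!
# Route `KLProgramme` — ENGINE child (stmt-HubbardSuperconductivity-20437 `KLRegimeEngineV17F2`): THE WITNESS of the deferred two-shell package —
# `∃ (A, u), 0 ≤ A ∧ (∀ R, 0 < u R) ∧ TwoShellFrameAreaAt A u` (step (T3d); design note HOME/hubbard-kl-k3c2-p2/TWO-SHELL-FRAME-PORT.md §10)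

Cell `gate-hubbard-kl`, seat hubbard-kl-k3c2-p2 g15.  The frame-class two-shell AREA predicate `TwoShellFrameAreaAt` of `…EngineV8DefsG11` (rev-13 image, package
`klTwoShellPack / klTS / klTSU`) is INHABITED: **`exists_twoShellFrameAreaAt`**.  Below the U-threshold
`u R = min 1 (min (κ₀⋆/((4/3)|Gfr₀| + 1)) (κ₁⋆/((8/3)|Gfr₁| + 1)))`, `κ₀⋆ = 1/100`, `κ₁⋆ = Dt_min/2` (bundle `bandBounds (−1.1) (−0.1)`), every admissible frame
(`FrameOK R U N μ K`, `μ ∈ klWindowC`) has frame-shift sizes `≤ κ₀⋆, κ₁⋆` on the square (`abs_negEval_le_of_frameOK`, `norm_fderiv_negEval_le_of_frameOK`, N-uniform) and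
the geometric constants `(7, 3/80, 1/2, 3/200)`; so the uniform area bound `exists_twoShell_area_uniform` (small shells) and the tube reduction with the trivial angular bound
(large shells, `volume_twoShell_le_frame`) give ONE constant `A` — exactly as `twoShell_volume_frameLevel_zero_le` did at `K = 0`.  Consequence for the engine:
`twoShellFrameAreaAt_klTwoShellPack` now yields the package's defining property (the `dif` branch is the `then` branch).
Everything is PROVED; no definitions, no named facts; nothing asserts any stub or superconductivity.
References: DECOMP App. E Lemmas E.1/E.3; FST II App. B [cite: FeldmanSalmhoferTrubowitz1998]; BGM 2006 §2.4, §2.7 [cite: BenfattoGiulianiMastropietro2006].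
-/

noncomputable section

namespace Summit.HubbardSuperconductivity.HubbardSuperconductivity.Theorems.EngineV8

set_option linter.dupNamespace false -- summit = problem name (single-conjunct summit), D-0017

open Real Set MeasureTheory
open scoped ENNReal
open Literature.MathematicalPhysics.QuantumLattice Literature.MathematicalPhysics.QuantumLattice.BandSectorCounting
open Literature.MathematicalPhysics.QuantumLattice.FermiRG
open Summit.HubbardSuperconductivity.HubbardSuperconductivity.Theorems.KLRegimeSplit
open Summit.HubbardSuperconductivity.HubbardSuperconductivity.Theorems.KLProgrammeLegKernels
open Summit.HubbardSuperconductivity.HubbardSuperconductivity.Theorems.DispersionFlow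
open Summit.HubbardSuperconductivity.HubbardSuperconductivity.Theorems.PerturbedFermiCurve

/-- The frame band in planar coordinates: `e_K(k) = ε₀(k₀, k₁) − K(k₀, k₁) − μ`. -/
theorem frameLevel_eq_planar (μ : ℝ) (K : TrigPolyC4v) (k : Momentum) :
    frameLevel μ K k = sqDispersion ![k 0, k 1] + -K.eval ![k 0, k 1] - μ := by
  have h := frameLevel_toLp μ K (WithLp.ofLp k)
  rw [WithLp.toLp_ofLp] at h
  have e : (WithLp.ofLp k : Fin 2 → ℝ) = ![k 0, k 1] := by funext i; fin_cases i <;> rfl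
  rw [h, frameShift_toLp]
  exact congrArg (fun v : Fin 2 → ℝ => sqDispersion v + -K.eval v - μ) e

/-- The engine's two-shell set of the frame band is the preimage of the planar two-shell set under `k ↦ (k 0, k 1)`. -/
theorem twoShell_frameLevel_eq_preimage (μ : ℝ) (K : TrigPolyC4v) (ε₁ ε₂ : ℝ) (w : Momentum) :
    {k : Momentum | k ∈ brillouinZone ∧ |frameLevel μ K k| < ε₁ ∧ |frameLevel μ K (k - w)| ≤ ε₂} =
      (fun k : Momentum => MeasurableEquiv.finTwoArrow (WithLp.ofLp k)) ⁻¹'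
        {x : ℝ × ℝ | (x.1 ∈ Ico (-π) π ∧ x.2 ∈ Ico (-π) π) ∧
          |sqDispersion ![x.1, x.2] + -K.eval ![x.1, x.2] - μ| < ε₁ ∧
          |sqDispersion (![x.1, x.2] - ![w 0, w 1]) + -K.eval (![x.1, x.2] - ![w 0, w 1]) - μ| ≤ ε₂} := by
  ext k
  have e : (![(k - w) 0, (k - w) 1] : Fin 2 → ℝ) = ![k 0, k 1] - ![w 0, w 1] := by
    funext i; fin_cases i <;> simp
  simp only [mem_setOf_eq, mem_preimage, brillouinZone, frameLevel_eq_planar, MeasurableEquiv.finTwoArrow_apply, Fin.forall_fin_two,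
    Fin.isValue, e]

/-- The planar two-shell set of the frame band is measurable. -/
theorem measurableSet_twoShell_planar (μ : ℝ) (K : TrigPolyC4v) (ε₁ ε₂ : ℝ) (wv : Fin 2 → ℝ) :
    MeasurableSet {x : ℝ × ℝ | (x.1 ∈ Ico (-π) π ∧ x.2 ∈ Ico (-π) π) ∧
        |sqDispersion ![x.1, x.2] + -K.eval ![x.1, x.2] - μ| < ε₁ ∧
        |sqDispersion (![x.1, x.2] - wv) + -K.eval (![x.1, x.2] - wv) - μ| ≤ ε₂} := by
  have hvec : Continuous fun x : ℝ × ℝ => (![x.1, x.2] : Fin 2 → ℝ) := by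
    refine continuous_pi fun i => ?_
    fin_cases i
    · simpa using continuous_fst
    · simpa using continuous_snd
  have hEc : Continuous fun k : Fin 2 → ℝ => sqDispersion k + -K.eval k :=
    (contDiff_one_sqDispersion.continuous).add (contDiff_frameShift_toLp K (m := 0)).continuous
  have h1 : MeasurableSet {x : ℝ × ℝ | x.1 ∈ Ico (-π) π ∧ x.2 ∈ Ico (-π) π} := by
    have : {x : ℝ × ℝ | x.1 ∈ Ico (-π) π ∧ x.2 ∈ Ico (-π) π} = Ico (-π) π ×ˢ Ico (-π) π := by
      ext x; simp [mem_prod]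
    rw [this]; exact measurableSet_Ico.prod measurableSet_Ico
  have hc1 : Continuous fun x : ℝ × ℝ => |sqDispersion ![x.1, x.2] + -K.eval ![x.1, x.2] - μ| :=
    ((hEc.comp hvec).sub continuous_const).abs
  have hc2 : Continuous fun x : ℝ × ℝ => |sqDispersion (![x.1, x.2] - wv) + -K.eval (![x.1, x.2] - wv) - μ| :=
    ((hEc.comp (hvec.sub continuous_const)).sub continuous_const).abs
  have hset : {x : ℝ × ℝ | (x.1 ∈ Ico (-π) π ∧ x.2 ∈ Ico (-π) π) ∧
      |sqDispersion ![x.1, x.2] + -K.eval ![x.1, x.2] - μ| < ε₁ ∧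
      |sqDispersion (![x.1, x.2] - wv) + -K.eval (![x.1, x.2] - wv) - μ| ≤ ε₂} =
      {x : ℝ × ℝ | x.1 ∈ Ico (-π) π ∧ x.2 ∈ Ico (-π) π} ∩
        ({x | |sqDispersion ![x.1, x.2] + -K.eval ![x.1, x.2] - μ| < ε₁} ∩
         {x | |sqDispersion (![x.1, x.2] - wv) + -K.eval (![x.1, x.2] - wv) - μ| ≤ ε₂}) := by
    ext x; simp only [mem_setOf_eq, mem_inter_iff]
  rw [hset]
  exact h1.inter ((measurableSet_lt hc1.measurable measurable_const).inter (measurableSet_le hc2.measurable measurable_const))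

/-- **THE TWO-SHELL WITNESS**: the frame-class two-shell area predicate is inhabited — `∃ (A, u), 0 ≤ A ∧ (∀ R, 0 < u R) ∧ TwoShellFrameAreaAt A u`
(DECOMP App. E Lemmas E.1/E.3 for every admissible frame of the engine, uniformly in the degree of the frame). [cite: FeldmanSalmhoferTrubowitz1998, App. B] -/
theorem exists_twoShellFrameAreaAt :
    ∃ Au : ℝ × (RenConsts → ℝ), 0 ≤ Au.1 ∧ (∀ R, 0 < Au.2 R) ∧ TwoShellFrameAreaAt Au.1 Au.2 := by
  have hπ := Real.pi_pos
  have ha : (-4 : ℝ) < -1.1 := by norm_num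
  have hab : (-1.1 : ℝ) ≤ -0.1 := by norm_num
  have hb : (-0.1 : ℝ) < 0 := by norm_num
  set B : BandBounds (-1.1) (-0.1) := bandBounds ha hab hb with hB
  have hDt := B.Dtmin_pos
  -- the frozen sizes
  set κ₀s : ℝ := 1 / 100 with hκ₀s
  set κ₁s : ℝ := B.Dtmin / 2 with hκ₁s
  have hκ₁0 : 0 ≤ κ₁s := by rw [hκ₁s]; positivity
  have hκ₁ : κ₁s < B.Dtmin := by rw [hκ₁s]; linarith
  have hηs : (0 : ℝ) < 1 / 50 := by norm_num
  obtain ⟨ε₀, C₁, C₂, hε₀, hC₁, hC₂, harea⟩ :=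
    exists_twoShell_area_uniform B (κ₀ := κ₀s) (Kc := 7) (r₀ := 3 / 80) (g₀ := 1 / 2) (w := 3 / 200) hκ₁0 hκ₁
      (by norm_num) (by norm_num) (by norm_num) (by norm_num) hηs
  set L : ℝ := 1 / (B.Dtmin - κ₁s) with hL
  have hL0 : 0 < L := by rw [hL]; exact div_pos one_pos (sub_pos.2 hκ₁)
  set A : ℝ := C₁ + C₂ + 32 * π * L / Real.sqrt ε₀ with hA
  have hsε₀ : 0 < Real.sqrt ε₀ := Real.sqrt_pos.2 hε₀
  have hA0 : 0 ≤ A := by rw [hA]; positivity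
  -- the U-threshold
  set u : RenConsts → ℝ := fun R => min 1 (min (κ₀s / (4 / 3 * |R.Gfr 0| + 1)) (κ₁s / (8 / 3 * |R.Gfr 1| + 1))) with hu
  have hκ₀s0 : 0 < κ₀s := by rw [hκ₀s]; norm_num
  have hκ₁s0 : 0 < κ₁s := by rw [hκ₁s]; positivity
  have hupos : ∀ R, 0 < u R := fun R => by
    rw [hu]; exact lt_min one_pos (lt_min (div_pos hκ₀s0 (by positivity)) (div_pos hκ₁s0 (by positivity)))
  refine ⟨(A, u), hA0, hupos, ?_⟩
  intro R hR U hU hUu μ hμ N K hK ε₁ ε₂ hε₁ h12 h2 w r hr hrw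
  have hμ1 : (-1.05 : ℝ) ≤ μ := hμ.1
  have hμ2 : μ ≤ (-0.15 : ℝ) := hμ.2
  have hE0 : klE0 = 1 / 32 := rfl
  have hε₂ : 0 < ε₂ := hε₁.trans_le h12
  have hε₁E : ε₁ ≤ 1 / 32 := by rw [← hE0]; exact h12.trans h2
  have hGfr : ∀ j, 0 ≤ R.Gfr j := hR.wf.2.2
  -- the sizes of the frame shift below the threshold
  have hU1 : U ≤ 1 := hUu.trans (by rw [hu]; exact min_le_left _ _)
  have hU2 : U ≤ κ₀s / (4 / 3 * |R.Gfr 0| + 1) := hUu.trans (by rw [hu]; exact (min_le_right _ _).trans (min_le_left _ _))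
  have hU3 : U ≤ κ₁s / (8 / 3 * |R.Gfr 1| + 1) := hUu.trans (by rw [hu]; exact (min_le_right _ _).trans (min_le_right _ _))
  have hδ : ∀ k : Fin 2 → ℝ, (∀ i, |k i| ≤ π) → |(fun k : Fin 2 → ℝ => -K.eval k) k| ≤ κ₀s := by
    intro k _
    refine (abs_negEval_le_of_frameOK hGfr hK k).trans ?_
    rw [abs_of_pos hU]
    have hU2' := hU2
    rw [abs_of_nonneg (hGfr 0)] at hU2'
    have hpos : 0 < 4 / 3 * R.Gfr 0 + 1 := by linarith only [hGfr 0]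
    have h1 : U * (4 / 3 * R.Gfr 0 + 1) ≤ κ₀s := by rw [le_div_iff₀ hpos] at hU2'; exact hU2'
    have h2 : 0 ≤ U := hU.le
    linarith only [h1, h2]
  have hκ : ∀ k : Fin 2 → ℝ, (∀ i, |k i| ≤ π) → ‖fderiv ℝ (fun k : Fin 2 → ℝ => -K.eval k) k‖ ≤ κ₁s := by
    intro k _
    refine (norm_fderiv_negEval_le_of_frameOK hGfr hK k).trans ?_
    have hU3' := hU3
    rw [abs_of_nonneg (hGfr 1)] at hU3'
    have hpos : 0 < 8 / 3 * R.Gfr 1 + 1 := by linarith only [hGfr 1]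
    have h1 : U * (8 / 3 * R.Gfr 1 + 1) ≤ κ₁s := by rw [le_div_iff₀ hpos] at hU3'; exact hU3'
    have hUU : U ^ 2 ≤ U := by
      calc U ^ 2 = U * U := sq U
        _ ≤ U * 1 := mul_le_mul_of_nonneg_left hU1 hU.le
        _ = U := mul_one U
    have h3 : 8 / 3 * R.Gfr 1 * U ^ 2 ≤ 8 / 3 * R.Gfr 1 * U := mul_le_mul_of_nonneg_left hUU (by linarith only [hGfr 1])
    have h2 : 0 ≤ U := hU.le
    linarith only [h1, h2, h3]
  have hG : GeomConstants (frameLevel μ K) 7 (3 / 80) (1 / 2) (3 / 200) := hK.1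
  -- transport to `ℝ × ℝ`
  set wv : Fin 2 → ℝ := ![w 0, w 1] with hwv
  rw [twoShell_frameLevel_eq_preimage,
    measurePreserving_momentum_prod.measure_preimage (measurableSet_twoShell_planar μ K ε₁ ε₂ ![w 0, w 1]).nullMeasurableSet]
  -- the torus distance of the transfer
  have hrw' : ∀ m : Fin 2 → ℤ, ∃ i, r ≤ |(![w 0, w 1] : Fin 2 → ℝ) i + m i * (2 * π)| := by
    intro m
    have h0 : torusAbs (w 0) ≤ |w 0 + m 0 * (2 * π)| := by
      have := torusAbs_le (w 0) (-m 0); rwa [show w 0 - ((-m 0 : ℤ) : ℝ) * (2 * π) = w 0 + m 0 * (2 * π) by push_cast; ring] at this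
    have h1 : torusAbs (w 1) ≤ |w 1 + m 1 * (2 * π)| := by
      have := torusAbs_le (w 1) (-m 1); rwa [show w 1 - ((-m 1 : ℤ) : ℝ) * (2 * π) = w 1 + m 1 * (2 * π) by push_cast; ring] at this
    have hr' : r ≤ max (torusAbs (w 0)) (torusAbs (w 1)) := hrw
    rcases le_total (torusAbs (w 0)) (torusAbs (w 1)) with hle | hle
    · refine ⟨1, ?_⟩; rw [max_eq_right hle] at hr'; simpa using hr'.trans h1
    · refine ⟨0, ?_⟩; rw [max_eq_left hle] at hr'; simpa using hr'.trans h0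
  have hsum0 : 0 ≤ ε₂ / r + Real.sqrt ε₂ := by positivity
  rcases le_or_gt ε₂ ε₀ with hsmall | hlarge
  · -- small shells: the uniform area bound
    have h := harea K μ hδ hκ hG μ (by norm_num [hκ₀s]; linarith) (by norm_num [hκ₀s]; linarith)
      (by rw [sub_self, abs_zero]; norm_num) ε₁ ε₂ ![w 0, w 1] r hε₁ h12 hsmall hr hrw'
    refine h.trans (ENNReal.ofReal_le_ofReal ?_)
    have h1 : C₁ * ε₁ * ε₂ / r + C₂ * ε₁ * Real.sqrt ε₂ ≤ (C₁ + C₂) * ε₁ * (ε₂ / r + Real.sqrt ε₂) := by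
      have e : (C₁ + C₂) * ε₁ * (ε₂ / r + Real.sqrt ε₂) =
          (C₁ * ε₁ * ε₂ / r + C₂ * ε₁ * Real.sqrt ε₂) + (C₁ * ε₁ * Real.sqrt ε₂ + C₂ * ε₁ * (ε₂ / r)) := by ring
      rw [e]
      have : 0 ≤ C₁ * ε₁ * Real.sqrt ε₂ + C₂ * ε₁ * (ε₂ / r) := by positivity
      linarith
    have h2 : (C₁ + C₂) * ε₁ * (ε₂ / r + Real.sqrt ε₂) ≤ A * ε₁ * (ε₂ / r + Real.sqrt ε₂) := by
      have h32 : 0 ≤ 32 * π * L / Real.sqrt ε₀ := by positivity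
      have hle : C₁ + C₂ ≤ A := by rw [hA]; linarith
      exact mul_le_mul_of_nonneg_right (mul_le_mul_of_nonneg_right hle hε₁.le) hsum0
    exact h1.trans h2
  · -- large shells: the tube reduction and the trivial angular bound `2π`
    have hlo : (-1.1 : ℝ) ≤ μ - κ₀s - ε₁ := by norm_num [hκ₀s]; linarith
    have hhi : μ + κ₀s + ε₁ ≤ (-0.1 : ℝ) := by norm_num [hκ₀s]; linarith
    have h := volume_twoShell_le_frame B hδ hκ hκ₁ μ ε₁ ε₂ ![w 0, w 1] hε₁ hlo hhi
    rw [← hL] at h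
    have hang : volume {θ ∈ Ioo (-π) π |
        |sqDispersion (perturbedFermiRadius (fun k : Fin 2 → ℝ => -K.eval k) μ θ • dir θ - ![w 0, w 1]) +
            -K.eval (perturbedFermiRadius (fun k : Fin 2 → ℝ => -K.eval k) μ θ • dir θ - ![w 0, w 1]) - μ| ≤ ε₂ + (4 + κ₁s) * L * ε₁} ≤
        ENNReal.ofReal (2 * π) := by
      calc _ ≤ volume (Ioo (-π) π) := measure_mono (fun θ hθ => hθ.1)
        _ = ENNReal.ofReal (2 * π) := by rw [Real.volume_Ioo]; ring_nf
    refine h.trans ?_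
    calc ENNReal.ofReal (16 * L * ε₁) * volume {θ ∈ Ioo (-π) π |
          |sqDispersion (perturbedFermiRadius (fun k : Fin 2 → ℝ => -K.eval k) μ θ • dir θ - ![w 0, w 1]) +
              -K.eval (perturbedFermiRadius (fun k : Fin 2 → ℝ => -K.eval k) μ θ • dir θ - ![w 0, w 1]) - μ| ≤ ε₂ + (4 + κ₁s) * L * ε₁}
        ≤ ENNReal.ofReal (16 * L * ε₁) * ENNReal.ofReal (2 * π) := by gcongr
      _ = ENNReal.ofReal (16 * L * ε₁ * (2 * π)) := (ENNReal.ofReal_mul (by positivity)).symm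
      _ ≤ ENNReal.ofReal (A * ε₁ * (ε₂ / r + Real.sqrt ε₂)) := ENNReal.ofReal_le_ofReal ?_
    have hsq : Real.sqrt ε₀ ≤ Real.sqrt ε₂ := Real.sqrt_le_sqrt hlarge.le
    have h1 : 16 * L * ε₁ * (2 * π) ≤ 32 * π * L / Real.sqrt ε₀ * ε₁ * Real.sqrt ε₂ := by
      have e : 32 * π * L / Real.sqrt ε₀ * ε₁ * Real.sqrt ε₂ = 16 * L * ε₁ * (2 * π) * (Real.sqrt ε₂ / Real.sqrt ε₀) := by
        field_simp
        ring
      rw [e]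
      have hq : 1 ≤ Real.sqrt ε₂ / Real.sqrt ε₀ := by rw [le_div_iff₀ hsε₀, one_mul]; exact hsq
      have h0 : 0 ≤ 16 * L * ε₁ * (2 * π) := by positivity
      nlinarith
    have h2 : 32 * π * L / Real.sqrt ε₀ * ε₁ * Real.sqrt ε₂ ≤ A * ε₁ * (ε₂ / r + Real.sqrt ε₂) := by
      have hle : 32 * π * L / Real.sqrt ε₀ ≤ A := by rw [hA]; linarith
      have hq0 : 0 ≤ ε₂ / r := by positivity
      have hs : Real.sqrt ε₂ ≤ ε₂ / r + Real.sqrt ε₂ := by linarith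
      calc 32 * π * L / Real.sqrt ε₀ * ε₁ * Real.sqrt ε₂ ≤ A * ε₁ * Real.sqrt ε₂ :=
            mul_le_mul_of_nonneg_right (mul_le_mul_of_nonneg_right hle hε₁.le) (Real.sqrt_nonneg _)
        _ ≤ A * ε₁ * (ε₂ / r + Real.sqrt ε₂) := mul_le_mul_of_nonneg_left hs (by positivity)
    exact h1.trans h2

end Summit.HubbardSuperconductivity.HubbardSuperconductivity.Theorems.EngineV8

end
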